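import Summits.BirchSwinnertonDyer.BirchSwinnertonDyer.Theorems.SchneiderFreeAdditiveX3AnomalousTwistLocalLines
import Literature.NumberTheory.EllipticCurves.KellerYin2024.PotentiallyGoodOrdinaryIwasawaTheory
import HarnessLib

/-!
# Route `SchneiderFreeAdditiveX3` (K1 door), crux r3 `GordTwoBranchIMC` (stmt-BirchSwinnertonDyer-19177): under Keller–Yin's lattice
# normalisation «every rational `3`-line of `W` is `D₃`-non-trivial» the rational `3`-line of the anomalous `(−3)`-twist is UNIQUE and every
# `Γ_K`-stable `3`-line of `W[3](ℚ̄)` is RATIONAL (`K` imaginary quadratic)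

Cell `bsd-schneider-ideate`, seat `bsd-schneider-door-c5` (prover, generation 31; assembly layer; `--supports` 19177, helper).
PARTITION: board row B6 ∩ X3 ∩ sst-twist, `r = 1` — the 1 725 ANOMALOUS pairs of the (G-ord, `e = 2`) half at `p = 3` (of 2 411).
bears_on: K1-door (items 18971/18972 retired → 19177 r3).  FILE 8a of the port of cell `bsd-eis`'s V21 INDEX ROAD to the door's ANOMALOUS TWIN
`W = C • V^{(−3)}` (FINDING-door-c5-g28 §5b `stub_λW`): the two rigidity lemmas behind the discharge (FILE 8b `…AnomalousTwistOrientation`) of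
the binders `hram` (orientation) and `htor` (`W(K)[3] = 0`) of FILES 3–7 from the door's form of Keller–Yin's normalisation (arXiv:2410.23241
§3.3 «the `G_p`-character of the rational line is non-trivial», tree `¬ LineDecompositionTrivialAt`), in its ∀-form
`hnorm : ∀ Ψ, IsRationalLine W 3 Ψ → ¬ LineDecompositionTrivialAt W 3 Ψ` (the analogue of x1's «no unramified rational line» `hlat`):
* §1 `lineDecompositionTrivialAt_of_forall_smul_eq` (a rational line fixed pointwise by ONE `D_𝔓` is `D`-trivial at every `𝔓 ∣ 3` —
  conjugation), `isRationalLine_unique_of_anomalousTwist` (two rational lines would both avoid FILE 1's `D`-trivial line `L₀`, so the Kummer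
  inertia element would act by `−1` on all of `W[3] = Ψ₁ ⊕ Ψ₂` yet trivially on `L₀`);
* §2 `isRationalLine_of_forall_restrict_smul_mem_of_anomalousTwist` — a `res(Γ_K)`-stable `3`-line of `W[3](ℚ̄)` is RATIONAL: x1's
  `ResidualLineRigidity.isRationalLine_of_forall_restrict_smul_mem` verbatim (complex conjugation, index `2`, three lines ⟹ scalars,
  `±1`-eigenvectors) with its `Anom`-uniqueness replaced by §1.

HONEST FRAMING: unconditional helper theorems (no definition, no named fact, no `sorry`); nothing analytic; no registered stub closed; no item
closed; BSD proved for no curve; «closes rung: none».  References: Keller–Yin arXiv:2410.23241 §3.3, arXiv:2402.12781v2 §1.3 [KellerYin2024];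
Serre 1972 §1.11 [Serre1972]; Greenberg–Vatsal 2000 p. 4, Thm. 1.3 [GreenbergVatsal2000]; Neukirch ANT I §9 [NeukirchANT1999]; x1
`ResidualLineRigidity` (template).
-/

set_option autoImplicit false
-- the route's Theorems namespace repeats the summit name by design (D-0017 nested layout)
set_option linter.dupNamespace false

noncomputable section

open scoped Classical Pointwise

namespace Summit.BirchSwinnertonDyer.BirchSwinnertonDyer.Theorems.SchneiderFreeAdditiveX3.AnomalousTwistRationalLine

open NumberField IsDedekindDomain Field WeierstrassCurve Rat.HeightOneSpectrum
  Literature.NumberTheory.EllipticCurves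
  Literature.NumberTheory.EllipticCurves.Rank1Residual Literature.NumberTheory.GaloisRepresentations
  Literature.NumberTheory.EllipticCurves.KellerYin2024
  Summit.BirchSwinnertonDyer.Rank1Residual Summit.BirchSwinnertonDyer.Rank1Residual.GaloisImage
  Summit.BirchSwinnertonDyer.BirchSwinnertonDyer.Theorems.ResidualLineRigidity
  Summit.BirchSwinnertonDyer.BirchSwinnertonDyer.Theorems.SchneiderFreeAdditiveX3.SemistableTwistLocal
  Summit.BirchSwinnertonDyer.BirchSwinnertonDyer.Theorems.SchneiderFreeAdditiveX3.AnomalousTwistLocalLines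

/-! ## §1. The rational line is unique under the normalisation -/

section RatSide

variable {V W : WeierstrassCurve ℚ} [V.IsElliptic] [V.IsGloballyMinimal] [W.IsElliptic] {p : ℕ} [hp : Fact p.Prime]

omit [V.IsElliptic] [V.IsGloballyMinimal] [W.IsElliptic] in
/-- **A rational line fixed pointwise by ONE decomposition group above `p` is `D`-trivial at `p`** (`LineDecompositionTrivialAt`, which
quantifies over every prime `𝔓 ∣ p`): the place of `ℚ` above `p` is unique (`Rat.asIdeal_eq_span_of_prime_mem`) and `D_{ρ𝔓} = ρ D_𝔓 ρ⁻¹`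
(`Ideal.decompositionSubgroup_smul`) with `ρ⁻¹ P ∈ Φ` for a rational `Φ`. [cite: NeukirchANT1999, Ch. I §9 Prop. (9.4)–(9.6)]
[cite: GreenbergVatsal2000, Thm. 1.3 (the kernel character restricted at p)] -/
theorem lineDecompositionTrivialAt_of_forall_smul_eq {Φ : AddSubgroup (geomTorsion W (p : ℤ))} (hΦ : IsRationalLine W p Φ)
    {v : HeightOneSpectrum (𝓞 ℚ)} (hpv : ((p : ℕ) : 𝓞 ℚ) ∈ v.asIdeal)
    {𝔓 : Ideal (absIntegers (𝓞 ℚ) ℚ)} (h𝔓 : 𝔓 ∈ v.primesAbove)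
    (hfix : ∀ g ∈ 𝔓.decompositionSubgroup (absoluteGaloisGroup ℚ), ∀ P ∈ Φ, g • P = P) :
    LineDecompositionTrivialAt W p Φ := by
  have hpP : p.Prime := hp.out
  intro v' hv' 𝔓' h𝔓' g hg P hP
  have hvv : v' = v := by
    apply HeightOneSpectrum.ext
    rw [Literature.NumberTheory.GaloisRepresentations.Rat.asIdeal_eq_span_of_prime_mem v' hpP hv',
      Literature.NumberTheory.GaloisRepresentations.Rat.asIdeal_eq_span_of_prime_mem v hpP hpv]
  subst hvv
  obtain ⟨ρ, hρ⟩ := IsDedekindDomain.HeightOneSpectrum.exists_smul_eq_of_mem_primesAbove_holds h𝔓 h𝔓'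
  have hg' : ρ⁻¹ * g * ρ ∈ 𝔓.decompositionSubgroup (absoluteGaloisGroup ℚ) := by
    rw [← hρ, Ideal.decompositionSubgroup_smul, Subgroup.mem_pointwise_smul_iff_inv_smul_mem, MulAut.smul_def,
      MulAut.conj_inv_apply] at hg
    exact hg
  have h := hfix _ hg' (ρ⁻¹ • P) (hΦ.2 ρ⁻¹ P hP)
  rw [mul_smul, mul_smul] at h
  have h' := congrArg (ρ • ·) h
  simpa only [smul_inv_smul] using h'

/-- **Under the normalisation «every rational `3`-line of `W` is `D₃`-non-trivial» the rational `3`-line of the anomalous `(−3)`-twist is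
UNIQUE.**  `V/ℚ` globally minimal good ordinary at `p = 3` with `3 ∣ a₃(V) − 1`, `W = C • V^{(p*)}`.  Two rational lines `Ψ₁ ≠ Ψ₂` are
`D_𝔓`-stable and both avoid FILE 1's `D_𝔓`-trivial line `L₀` (§1 + the normalisation), so the Kummer inertia element `τ` (`τ T + T ∈ L₀`) acts
by `−1` on each, hence on `W[3] = Ψ₁ ⊕ Ψ₂` — but trivially on `L₀ ≠ 0`. The door analogue of x1's `ResidualLineRigidity.isRationalLine_unique`.
[cite: KellerYin2024, §1.3 Prop. 1.3.1 (arXiv:2402.12781v2); arXiv:2410.23241 §3.3 (the normalisation)] [cite: Serre1972, §1.11] -/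
theorem isRationalLine_unique_of_anomalousTwist (hp3 : p = 3) (hV : GoodOrd V p) (ha : (p : ℤ) ∣ V.frobeniusTrace p - 1)
    (C : VariableChange ℚ) (hC : C • V.quadraticTwist ((-1 : ℚ) ^ (p / 2) * p) = W)
    (hnorm : ∀ Ψ : AddSubgroup (geomTorsion W (p : ℤ)), IsRationalLine W p Ψ → ¬ LineDecompositionTrivialAt W p Ψ)
    {Ψ₁ Ψ₂ : AddSubgroup (geomTorsion W (p : ℤ))} (hΨ₁ : IsRationalLine W p Ψ₁) (hΨ₂ : IsRationalLine W p Ψ₂) : Ψ₁ = Ψ₂ := by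
  have hpP : p.Prime := hp.out
  have hp2 : p ≠ 2 := by omega
  obtain ⟨v, hpv⟩ := ResidualLineRigidity.exists_heightOneSpectrum_natCast_mem hpP
  obtain ⟨𝔓, h𝔓⟩ := v.primesAbove_nonempty
  have hID : 𝔓.inertia (absoluteGaloisGroup ℚ) ≤ 𝔓.decompositionSubgroup (absoluteGaloisGroup ℚ) :=
    Ideal.inertia_le_decompositionSubgroup _ _
  obtain ⟨L₀, hL₀, hfix, τ, hτI, hτ⟩ := exists_trivLine_of_anomalous_pStar_twist hp3 hV ha C hC hpv h𝔓
  -- both rational lines avoid `L₀`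
  have havoid : ∀ Ψ : AddSubgroup (geomTorsion W (p : ℤ)), IsRationalLine W p Ψ → Ψ ⊓ L₀ = ⊥ := by
    intro Ψ hΨ
    rcases line_eq_or_inf_eq_bot hΨ.1 hL₀ with heq | hinf
    · exact absurd (lineDecompositionTrivialAt_of_forall_smul_eq hΨ hpv h𝔓 (heq ▸ hfix)) (hnorm Ψ hΨ)
    · exact hinf
  -- `τ` acts by `-1` on each
  have hneg : ∀ Ψ : AddSubgroup (geomTorsion W (p : ℤ)), IsRationalLine W p Ψ → ∀ P ∈ Ψ, τ • P = -P := by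
    intro Ψ hΨ P hP
    have h1 : τ • P + P ∈ Ψ ⊓ L₀ := ⟨Ψ.add_mem (hΨ.2 τ P hP) hP, hτ P⟩
    rw [havoid Ψ hΨ, AddSubgroup.mem_bot] at h1
    exact eq_neg_of_add_eq_zero_left h1
  by_contra hne
  obtain ⟨-, hsup⟩ := SemistableTwistLocalAnyLine.inf_eq_bot_and_sup_eq_top_of_ne hpP
    (Rank1Residual.natCard_geomTorsion W p) hΨ₁.1 hΨ₂.1 hne
  -- `τ = -1` on `W[p]`, but `τ` fixes `L₀ ≠ 0`
  obtain ⟨x, hxL, hx⟩ := exists_mem_ne_zero_of_natCard_eq hL₀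
  have hxsup : x ∈ Ψ₁ ⊔ Ψ₂ := by rw [hsup]; exact AddSubgroup.mem_top x
  obtain ⟨a, ha', b, hb, rfl⟩ := AddSubgroup.mem_sup.mp hxsup
  have h1 : τ • (a + b) = -(a + b) := by rw [smul_add, hneg Ψ₁ hΨ₁ a ha', hneg Ψ₂ hΨ₂ b hb, neg_add]
  have h2 : τ • (a + b) = a + b := hfix τ (hID hτI) _ hxL
  rw [h2] at h1
  have h3 : (a + b) + (a + b) = 0 := by
    nth_rewrite 2 [h1]
    exact add_neg_cancel _
  exact hx (eq_zero_of_add_self_eq_zero hp2 h3)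

end RatSide

/-! ## §2. A `Γ_K`-stable `3`-line of `W[3](ℚ̄)` is rational -/

section Quadratic

variable {V W : WeierstrassCurve ℚ} [V.IsElliptic] [V.IsGloballyMinimal] [W.IsElliptic] {p : ℕ} [hp : Fact p.Prime]
  {K : Type} [Field K] [NumberField K]

/-- **A `Γ_K`-stable `p`-line of `W[p](ℚ̄)` is rational** (`K` imaginary quadratic; `W` the anomalous `(−3)`-twist under the normalisation):
x1's `ResidualLineRigidity.isRationalLine_of_forall_restrict_smul_mem` VERBATIM — complex conjugation `c ∉ res(Γ_K)`, index `2`, a line stable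
under `res(Γ_K)` and `c` is rational, the conjugate line `cΨ` is `res(Γ_K)`-stable, and three distinct `Γ_K`-stable lines force scalars whose
`±1`-eigenvectors span rational lines — with the uniqueness of the rational line now §1's. [cite: Serre1972, §1.11] [cite: GreenbergVatsal2000, p. 4] -/
theorem isRationalLine_of_forall_restrict_smul_mem_of_anomalousTwist (hp3 : p = 3) (hV : GoodOrd V p)
    (ha : (p : ℤ) ∣ V.frobeniusTrace p - 1)
    (C : VariableChange ℚ) (hC : C • V.quadraticTwist ((-1 : ℚ) ^ (p / 2) * p) = W)
    (hnorm : ∀ Ψ : AddSubgroup (geomTorsion W (p : ℤ)), IsRationalLine W p Ψ → ¬ LineDecompositionTrivialAt W p Ψ)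
    (hred : Red W p) (hK : IsImaginaryQuadratic K) {Ψ : AddSubgroup (geomTorsion W (p : ℤ))} (hΨ : Nat.card Ψ = p)
    (hstab : ∀ (τ : absoluteGaloisGroup K), ∀ P ∈ Ψ, absGaloisRestrict ℚ K τ • P ∈ Ψ) :
    IsRationalLine W p Ψ := by
  have hp2 : p ≠ 2 := by omega
  -- the rational line `Φ₀` and its uniqueness
  obtain ⟨Φ₀, hΦ₀⟩ := exists_isRationalLine_of_not_irr W p hred
  have huniq : ∀ Φ, IsRationalLine W p Φ → Φ = Φ₀ := fun Φ hΦ ↦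
    isRationalLine_unique_of_anomalousTwist hp3 hV ha C hC hnorm hΦ hΦ₀
  by_cases hΨ0 : Ψ = Φ₀
  · rw [hΨ0]; exact hΦ₀
  -- complex conjugation `c ∉ Γ_K`, the index-2 structure
  haveI : IsTotallyComplex K := hK.2
  obtain ⟨c, hc⟩ := exists_isComplexConjugation (Rat.castHom ℝ)
  have hcK : c ∉ Set.range (absGaloisRestrict ℚ K) :=
    hc.not_mem_range_absGaloisRestrict (L := K) (fun w ↦ IsTotallyComplex.isComplex w)
  have hc2 : c * c = 1 := by rw [← pow_two]; exact hc.sq_eq_one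
  have hcinv : c⁻¹ = c := inv_eq_of_mul_eq_one_left hc2
  have hidx : (absGaloisRestrict ℚ K).range.index = 2 := by
    rw [index_range_absGaloisRestrict_eq_finrank, hK.1]
  haveI hnormal : (absGaloisRestrict ℚ K).range.Normal := Subgroup.normal_of_index_eq_two hidx
  have hconj : ∀ τ : absoluteGaloisGroup K, ∃ τ' : absoluteGaloisGroup K,
      absGaloisRestrict ℚ K τ' = c⁻¹ * absGaloisRestrict ℚ K τ * c := fun τ ↦ by
    obtain ⟨τ', hτ'⟩ := hnormal.conj_mem _ ⟨τ, rfl⟩ c⁻¹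
    rw [inv_inv] at hτ'
    exact ⟨τ', hτ'⟩
  have hcoset : ∀ g : absoluteGaloisGroup ℚ, g ∉ Set.range (absGaloisRestrict ℚ K) →
      ∃ τ : absoluteGaloisGroup K, g = c * absGaloisRestrict ℚ K τ := fun g hg ↦ by
    obtain ⟨τ, hτ⟩ := inv_mul_mem_range_absGaloisRestrict hK.1 hcK hg
    exact ⟨τ, by rw [hτ, mul_inv_cancel_left]⟩
  -- a line stable under `Γ_K` and under `c` is rational
  have hrat : ∀ Φ : AddSubgroup (geomTorsion W (p : ℤ)), Nat.card Φ = p →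
      (∀ (τ : absoluteGaloisGroup K), ∀ P ∈ Φ, absGaloisRestrict ℚ K τ • P ∈ Φ) →
      (∀ P ∈ Φ, c • P ∈ Φ) → IsRationalLine W p Φ := by
    intro Φ hΦ hτ hcΦ
    refine ⟨hΦ, fun g P hP ↦ ?_⟩
    by_cases hg : g ∈ Set.range (absGaloisRestrict ℚ K)
    · obtain ⟨τ, rfl⟩ := hg
      exact hτ τ P hP
    · obtain ⟨τ, rfl⟩ := hcoset g hg
      rw [mul_smul]
      exact hcΦ _ (hτ τ P hP)
  -- the conjugate line `c • Ψ` is `Γ_K`-stable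
  set cΨ : AddSubgroup (geomTorsion W (p : ℤ)) :=
    Ψ.map (DistribSMul.toAddMonoidHom (geomTorsion W (p : ℤ)) c) with hcΨdef
  have hcΨcard : Nat.card cΨ = p := natCard_map_eq c hΨ
  have hmem_cΨ : ∀ {P}, P ∈ cΨ ↔ c • P ∈ Ψ := fun {P} ↦ by
    constructor
    · rintro ⟨Q, hQ, rfl⟩
      change c • (c • Q) ∈ Ψ
      rwa [← mul_smul, hc2, one_smul]
    · intro h
      exact ⟨c • P, h, by change c • (c • P) = P; rw [← mul_smul, hc2, one_smul]⟩
  have hcΨstab : ∀ (τ : absoluteGaloisGroup K), ∀ P ∈ cΨ, absGaloisRestrict ℚ K τ • P ∈ cΨ := by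
    intro τ P hP
    obtain ⟨τ', hτ'⟩ := hconj τ
    rw [hmem_cΨ] at hP ⊢
    rw [← mul_smul, show c * absGaloisRestrict ℚ K τ = absGaloisRestrict ℚ K τ' * c by
      rw [hτ', hcinv, mul_assoc (c * absGaloisRestrict ℚ K τ), hc2, mul_one], mul_smul]
    exact hstab τ' _ hP
  by_cases hcΨ : cΨ = Ψ
  · -- `Ψ` is `c`-stable, hence rational
    refine hrat Ψ hΨ hstab fun P hP ↦ ?_
    have : P ∈ cΨ := hcΨ.symm ▸ hP
    exact hmem_cΨ.mp this
  · -- three `Γ_K`-stable lines `Φ₀, Ψ, cΨ`: `Γ_K` acts by scalars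
    exfalso
    have hΦ₀c : ∀ P ∈ Φ₀, c • P ∈ Φ₀ := fun P hP ↦ hΦ₀.2 c P hP
    have hcΨ0 : cΨ ≠ Φ₀ := by
      intro h
      apply hΨ0
      ext P
      constructor
      · intro hP
        have h1 : c • P ∈ cΨ := hmem_cΨ.mpr (by rwa [← mul_smul, hc2, one_smul])
        rw [h] at h1
        have h2 := hΦ₀c _ h1
        rwa [← mul_smul, hc2, one_smul] at h2
      · intro hP
        have h1 : c • P ∈ Φ₀ := hΦ₀c P hP
        rw [← h] at h1
        have h2 := hmem_cΨ.mp h1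
        rwa [← mul_smul, hc2, one_smul] at h2
    have hscalar : ∀ τ : absoluteGaloisGroup K, ∃ a : ℤ, ∀ P : geomTorsion W (p : ℤ),
        absGaloisRestrict ℚ K τ • P = a • P := fun τ ↦
      exists_int_smul_eq_of_three_lines hΦ₀.1 hΨ hcΨcard (Ne.symm hΨ0) (Ne.symm hcΨ0)
        (Ne.symm hcΨ) (fun P hP ↦ hΦ₀.2 _ P hP) (hstab τ) (hcΨstab τ)
    -- the `±1`-eigenvectors of `c` span rational lines, both equal to `Φ₀`
    obtain ⟨⟨P, hP0, hcP⟩, ⟨Q, hQ0, hcQ⟩⟩ :=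
      exists_fixed_and_antifixed_of_isComplexConjugation W hp2 c hc
    have hline : ∀ R : geomTorsion W (p : ℤ), R ≠ 0 → (c • R = R ∨ c • R = -R) →
        AddSubgroup.zmultiples R = Φ₀ := by
      intro R hR0 hcR
      refine huniq _ (hrat _ (natCard_zmultiples_eq hR0) (fun τ S hS ↦ ?_) (fun S hS ↦ ?_))
      · obtain ⟨m, rfl⟩ := AddSubgroup.mem_zmultiples_iff.mp hS
        obtain ⟨a, ha⟩ := hscalar τ
        rw [ha, smul_comm a m R]
        exact AddSubgroup.zsmul_mem _ (AddSubgroup.zsmul_mem _ (AddSubgroup.mem_zmultiples R) a) m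
      · obtain ⟨m, rfl⟩ := AddSubgroup.mem_zmultiples_iff.mp hS
        rw [smul_comm c m R]
        rcases hcR with h | h
        · rw [h]; exact AddSubgroup.zsmul_mem _ (AddSubgroup.mem_zmultiples R) m
        · rw [h, smul_neg]
          exact AddSubgroup.neg_mem _ (AddSubgroup.zsmul_mem _ (AddSubgroup.mem_zmultiples R) m)
    have hPΦ := hline P hP0 (Or.inl hcP)
    have hQΦ := hline Q hQ0 (Or.inr hcQ)
    have hQP : Q ∈ AddSubgroup.zmultiples P := by
      rw [hPΦ, ← hQΦ]; exact AddSubgroup.mem_zmultiples Q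
    obtain ⟨k, hk⟩ := AddSubgroup.mem_zmultiples_iff.mp hQP
    have hcQ' : c • Q = Q := by rw [← hk, smul_comm c k P, hcP]
    rw [hcQ'] at hcQ
    have h2 : Q + Q = 0 := by
      nth_rewrite 2 [hcQ]
      exact add_neg_cancel Q
    exact hQ0 (eq_zero_of_add_self_eq_zero hp2 h2)

end Quadratic

end Summit.BirchSwinnertonDyer.BirchSwinnertonDyer.Theorems.SchneiderFreeAdditiveX3.AnomalousTwistRationalLine

end
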